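import Summits.AtomisticToContinuum.HydrodynamicLimit.Theorems.EquilibriumClampedCollisionalWindowLD.Negative.LatticeDefs

/-!
# The line lattice: lifted coordinates and deviation bounds (helper file of the refutation of `EquilibriumClampedCollisionalWindowLD`, stmt-AtomisticToContinuum-13733; see `Cruxes/EquilibriumClampedCollisionalWindowLD/Disproof.lean` and the evidence WITNESS.md; no Theses declaration is asserted positively; refuter-cdisprove-stmt-AtomisticToContinuum-13733-0)
-/

noncomputable section

open Real
open scoped InnerProductSpace

namespace Summit.AtomisticToContinuum.HydrodynamicLimit.Theorems

namespace EquilibriumClampedCollisionalWindowLDNegative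

section Lattice

open Literature.Analysis.FluidPDE Literature.Analysis.FunctionSpaces
open Filter
open scoped Topology

namespace Lat

variable {Λ : Lat} {N : ℕ} {a : Fin (N + 1) ≃ Λ.Slot}

/-! ### The certificate in lifted coordinates; deviation bounds -/

/-- The certificate's positions are projections of the lifted positions. [folklore] -/
theorem cert_fst (z : Cfg N) (t : ℝ) (p : Fin (N + 1)) :
    (Λ.cert a z t p).1 = Torus.proj (Λ.liftPos a z t p) := by
  classical
  unfold cert liftPos
  split_ifs with h
  · rfl
  · rw [Λ.pos_eq_proj a z p, ← Torus.proj_add]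

/-- The certificate's velocities. [folklore] -/
theorem cert_snd (z : Cfg N) (t : ℝ) (p : Fin (N + 1)) : (Λ.cert a z t p).2 = Λ.certVel a z t p := by
  classical
  unfold cert certVel
  split_ifs with h <;> rfl

/-- The certificate as a pair. [folklore] -/
theorem cert_apply (z : Cfg N) (t : ℝ) (p : Fin (N + 1)) :
    Λ.cert a z t p = (Torus.proj (Λ.liftPos a z t p), Λ.certVel a z t p) :=
  Prod.ext (cert_fst z t p) (cert_snd z t p)

/-- `liftPos_active` (technical, see the section header). [folklore] -/
theorem liftPos_active (z : Cfg N) (t : ℝ) (p : Fin (N + 1)) (h : Λ.Active (Λ.blk (a p))) :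
    Λ.liftPos a z t p =
      Λ.blockVec (Λ.blk (a p)) (a p).2 + pos Λ.P (bv 0) (Λ.bdata a z (Λ.blk (a p)) (a p).2) (Λ.loc (a p)) t := by
  classical
  unfold liftPos; rw [if_pos h]

/-- `liftPos_parked` (technical, see the section header). [folklore] -/
theorem liftPos_parked (z : Cfg N) (t : ℝ) (p : Fin (N + 1)) (h : ¬ Λ.Active (Λ.blk (a p))) :
    Λ.liftPos a z t p = Λ.slotVec (a p) + Λ.offset a z p + t • (z p).2 := by
  classical
  unfold liftPos; rw [if_neg h]

/-- `certVel_active` (technical, see the section header). [folklore] -/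
theorem certVel_active (z : Cfg N) (t : ℝ) (p : Fin (N + 1)) (h : Λ.Active (Λ.blk (a p))) :
    Λ.certVel a z t p = vel Λ.P (bv 0) (Λ.bdata a z (Λ.blk (a p)) (a p).2) (Λ.loc (a p)) t := by
  classical
  unfold certVel; rw [if_pos h]

/-- `certVel_parked` (technical, see the section header). [folklore] -/
theorem certVel_parked (z : Cfg N) (t : ℝ) (p : Fin (N + 1)) (h : ¬ Λ.Active (Λ.blk (a p))) :
    Λ.certVel a z t p = (z p).2 := by
  classical
  unfold certVel; rw [if_neg h]

/-- `K ≥ 2` on an OK lattice. -/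
theorem two_le_K (hΛ : Λ.OK) : 2 ≤ Λ.P.K := by have := hΛ.K_eq; have := hΛ.m_ge; omega

/-- Window times are before every active block's pulse reaches its buffer. [folklore] -/
theorem w_lt_tHit (hW : Λ.WinOK) {z : Cfg N} (hz : z ∈ Λ.Ev a) {b : ℕ} (hb : Λ.Active b)
    (ℓ : Fin Λ.n × Fin Λ.n) : Λ.w < tHit Λ.P (bv 0) (Λ.bdata a z b ℓ) (Λ.P.K - 1) :=
  hW.w_lt.trans_le (tHit_ge hW.ok.sep.adm (dataOK_of_mem hW.ok hz hb ℓ) (Nat.sub_le _ _))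

/-- Parked spheres have zero nominal velocity. [folklore] -/
theorem drv_of_not_active {ς : Λ.Slot} (h : ¬ Λ.Active (Λ.blk ς)) : Λ.drv ς = 0 := by
  classical
  unfold drv; rw [if_neg (fun hd => h hd.1)]

/-- **Deviation bounds (movers and everybody)**: on the window every lifted position is within
`fwd` of its slot and never more than `errA` behind it (coordinate `0`). [folklore] -/
theorem liftPos_dev (hW : Λ.WinOK) {z : Cfg N} (hz : z ∈ Λ.Ev a) {t : ℝ} (ht0 : 0 ≤ t) (htw : t ≤ Λ.w)
    (p : Fin (N + 1)) :
    -Λ.P.errA ≤ (Λ.liftPos a z t p - Λ.slotVec (a p)) 0 ∧ ‖Λ.liftPos a z t p - Λ.slotVec (a p)‖ ≤ Λ.P.fwd := by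
  have hΛ := hW.ok
  have hP := hΛ.sep.adm
  have htT : t ≤ Λ.P.Tmax := htw.trans hW.w_le_T
  by_cases hb : Λ.Active (Λ.blk (a p))
  · have hD := dataOK_of_mem hΛ hz hb (a p).2
    have hκ := loc_le_K hΛ (a p)
    have hform : Λ.liftPos a z t p - Λ.slotVec (a p) =
        pos Λ.P (bv 0) (Λ.bdata a z (Λ.blk (a p)) (a p).2) (Λ.loc (a p)) t - ((Λ.loc (a p) : ℝ) * Λ.P.s) • bv 0 := by
      rw [liftPos_active z t p hb, Λ.slotVec_eq (a p)]; abel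
    have hph : t < tHit Λ.P (bv 0) (Λ.bdata a z (Λ.blk (a p)) (a p).2) (Λ.loc (a p)) ∨ Λ.loc (a p) + 1 ≤ Λ.P.K := by
      rcases Nat.lt_or_ge (Λ.loc (a p)) Λ.P.K with h | h
      · exact Or.inr h
      · left
        have hK : Λ.loc (a p) = Λ.P.K := le_antisymm hκ h
        have h1 := w_lt_tHit hW hz hb (a p).2
        have h2 := tHit_mono hP hD (Nat.sub_le Λ.P.K 1) le_rfl
        rw [hK]; linarith
    have hc := pos_coarse hP hD hΛ.sep.αs_le hκ ht0 htT hph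
    rw [hform]
    exact ⟨by rw [← inner_bv]; exact hc.1, hc.2⟩
  · have hform : Λ.liftPos a z t p - Λ.slotVec (a p) = Λ.offset a z p + t • (z p).2 := by
      rw [liftPos_parked z t p hb]; abel
    have hv : ‖(z p).2‖ ≤ Λ.P.u := by
      have := (hz p).2; rwa [drv_of_not_active hb, sub_zero] at this
    have hsmall : ‖Λ.offset a z p + t • (z p).2‖ ≤ Λ.P.r + Λ.P.Tmax * Λ.P.u := by
      calc ‖Λ.offset a z p + t • (z p).2‖ ≤ ‖Λ.offset a z p‖ + ‖t • (z p).2‖ := norm_add_le _ _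
        _ ≤ Λ.P.r + Λ.P.Tmax * Λ.P.u := by
            refine add_le_add (hz p).1 ?_
            rw [norm_smul, Real.norm_of_nonneg ht0]
            exact mul_le_mul htT hv (norm_nonneg _) hP.T_nn
    have he1 : Λ.P.r + Λ.P.Tmax * Λ.P.u ≤ Λ.P.errA := by
      unfold Params.errA; have := hP.T_nn; have := hP.ρs_nn; nlinarith
    have he2 : Λ.P.errA ≤ Λ.P.fwd := by
      unfold Params.fwd Params.errA
      have := mul_nonneg hP.θhi_pos.le hP.Vhi_pos.le; linarith
    rw [hform]
    refine ⟨?_, hsmall.trans (he1.trans he2)⟩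
    have := abs_apply_le_norm (Λ.offset a z p + t • (z p).2) 0
    rw [abs_le] at this
    linarith [this.1]

/-- Frozen slots: not a driver/relay slot of an active block. [folklore] -/
def Frozen (Λ : Lat) (ς : Λ.Slot) : Prop := ¬ (Λ.Active (Λ.blk ς) ∧ Λ.loc ς + 3 ≤ Λ.m)

/-- **Frozen spheres barely move**: within `r + Tmax u` of their slot on the window. [folklore] -/
theorem liftPos_dev_frozen (hW : Λ.WinOK) {z : Cfg N} (hz : z ∈ Λ.Ev a) {t : ℝ} (ht0 : 0 ≤ t)
    (htw : t ≤ Λ.w) {p : Fin (N + 1)} (hf : Λ.Frozen (a p)) :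
    ‖Λ.liftPos a z t p - Λ.slotVec (a p)‖ ≤ Λ.P.r + Λ.P.Tmax * Λ.P.u := by
  have hΛ := hW.ok
  have hP := hΛ.sep.adm
  have htT : t ≤ Λ.P.Tmax := htw.trans hW.w_le_T
  by_cases hb : Λ.Active (Λ.blk (a p))
  · have hD := dataOK_of_mem hΛ hz hb (a p).2
    have hκ := loc_le_K hΛ (a p)
    have hκ1 : Λ.P.K - 1 ≤ Λ.loc (a p) := by
      have : ¬ (Λ.loc (a p) + 3 ≤ Λ.m) := fun h => hf ⟨hb, h⟩
      have := hΛ.K_eq; omega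
    have hform : Λ.liftPos a z t p - Λ.slotVec (a p) =
        pos Λ.P (bv 0) (Λ.bdata a z (Λ.blk (a p)) (a p).2) (Λ.loc (a p)) t - ((Λ.loc (a p) : ℝ) * Λ.P.s) • bv 0 := by
      rw [liftPos_active z t p hb, Λ.slotVec_eq (a p)]; abel
    have ht : t < tHit Λ.P (bv 0) (Λ.bdata a z (Λ.blk (a p)) (a p).2) (Λ.loc (a p)) := by
      have h1 := w_lt_tHit hW hz hb (a p).2
      have h2 := tHit_mono hP hD hκ1 hκ
      linarith
    rw [hform]
    exact pos_bounds_untouched hP hD (by have := two_le_K hΛ; omega) hκ ht0 htT ht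
  · rw [liftPos_parked z t p hb]
    have hv : ‖(z p).2‖ ≤ Λ.P.u := by
      have := (hz p).2; rwa [drv_of_not_active hb, sub_zero] at this
    have : Λ.slotVec (a p) + Λ.offset a z p + t • (z p).2 - Λ.slotVec (a p) = Λ.offset a z p + t • (z p).2 := by
      abel
    rw [this]
    calc ‖Λ.offset a z p + t • (z p).2‖ ≤ ‖Λ.offset a z p‖ + ‖t • (z p).2‖ := norm_add_le _ _
      _ ≤ Λ.P.r + Λ.P.Tmax * Λ.P.u := by
          refine add_le_add (hz p).1 ?_
          rw [norm_smul, Real.norm_of_nonneg ht0]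
          exact mul_le_mul htT hv (norm_nonneg _) hP.T_nn

/-- `r + Tmax u ≤ errA ≤ fwd`. [folklore] -/
theorem e1_le_errA (hP : Λ.P.Admissible) : Λ.P.r + Λ.P.Tmax * Λ.P.u ≤ Λ.P.errA ∧ Λ.P.errA ≤ Λ.P.fwd := by
  constructor
  · unfold Params.errA; have := hP.T_nn; have := hP.ρs_nn; nlinarith
  · unfold Params.fwd Params.errA
    have := mul_nonneg hP.θhi_pos.le hP.Vhi_pos.le; linarith

/-- **Adjacency forces freezing**: if the slot right after `ς` on its line is not in the same
active block, then `ς` is frozen. [folklore] -/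
theorem frozen_of_next (hΛ : Λ.OK) {ς ς' : Λ.Slot} (hnext : ς'.1.1 = ς.1.1 + 1)
    (hnot : ¬ (Λ.Active (Λ.blk ς) ∧ Λ.blk ς = Λ.blk ς')) : Λ.Frozen ς := by
  rintro ⟨hact, hloc⟩
  apply hnot
  refine ⟨hact, ?_⟩
  have h1 := Λ.blk_mul_add_loc ς
  have h2 := Λ.blk_mul_add_loc ς'
  have hm : 0 < Λ.m := by have := hΛ.m_ge; omega
  have hl' : Λ.loc ς' < Λ.m := loc_lt hΛ ς'
  have hl : Λ.loc ς < Λ.m := loc_lt hΛ ς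
  -- `blk ς' * m + loc ς' = blk ς * m + (loc ς + 1)` with both remainders `< m`
  have key : Λ.blk ς' * Λ.m + Λ.loc ς' = Λ.blk ς * Λ.m + (Λ.loc ς + 1) := by omega
  have e1 : (Λ.blk ς' * Λ.m + Λ.loc ς') / Λ.m = Λ.blk ς' := by
    rw [Nat.add_comm, Nat.add_mul_div_right _ _ hm, Nat.div_eq_of_lt hl', zero_add]
  have e2 : (Λ.blk ς * Λ.m + (Λ.loc ς + 1)) / Λ.m = Λ.blk ς := by
    rw [Nat.add_comm, Nat.add_mul_div_right _ _ hm, Nat.div_eq_of_lt (by omega), zero_add]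
  rw [key] at e1
  exact e2.symm.trans e1

/-- The last slot of a line is frozen. [folklore] -/
theorem frozen_last {ς : Λ.Slot} (hlast : ς.1.1 + 1 = Λ.M) : Λ.Frozen ς := by
  rintro ⟨hact, hloc⟩
  have h1 := Λ.blk_mul_add_loc ς
  have hQ : Λ.blk ς < Λ.Q := hact.1
  have h2 : (Λ.blk ς + 1) * Λ.m ≤ Λ.Q * Λ.m := Nat.mul_le_mul_right _ hQ
  have h3 : Λ.Q * Λ.m ≤ Λ.M := Nat.div_mul_le_self _ _
  have : ς.1.1 + 3 ≤ (Λ.blk ς + 1) * Λ.m := by rw [Nat.add_mul, one_mul]; omega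
  omega

end Lat

end Lattice

end EquilibriumClampedCollisionalWindowLDNegative

end Summit.AtomisticToContinuum.HydrodynamicLimit.Theorems

end
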